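import Summits.CriticalPhenomena.PercolationContinuityZ3.Theorems.PercNearOneGluingNoHeavyQuantTopFlippedLightSharpFloorCellsLH
import Summits.CriticalPhenomena.PercolationContinuityZ3.Theorems.PercNearOneGluingNoHeavyQuantTopFlippedLightSharpFloorCellsLL
import Summits.CriticalPhenomena.PercolationContinuityZ3.Theorems.PercNearOneGluingNoHeavyQuantTwoBlobTopFlippedLightFloor
import HarnessLib

/-!
# QUANT lane R8, T-DEC, binder (II): THE EXACT FLOOR THRESHOLD OF THE STANDALONE TOP-FLIPPED LIGHT PIECES — DEC at EVERY aspect ratio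
# iff the floor satisfies `x³ + x² + 3x ≥ 1` (part 3: capacity inequalities, `DECAtT` statements, kernel witnesses below the threshold)

builds on p205010 (kernel theorem, internal audit signed; external expert review pending)

Support file (`--supports stmt-CriticalPhenomena-4575`), QUANT lane seat prim-quant-arm-2 (gen 32), rung R8 of
`run/shared/lean/prim/quant/LADDER.md`.  Theorems only, standard axioms, no sorries, no definitions.

Arm-2 g31 proved the top-flipped light pieces (`LAW2[A, γ; B, g]`, light cell(s) `x² < γ < x`, target the sum of the ARCH credits, cross
atoms mids, top a giant) standalone DEC under the ASPECT hypothesis "a light cell is at most 4 times as long as its partner"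
(`…TwoBlobTopFlippedLight{Heavy,Light}`) and, without any aspect hypothesis, for FLOORS `x ≥ 1/3` (`…TwoBlobTopFlippedLightFloor`), locating
the exact floor threshold numerically at `(1 − x)³ = 4x²`.  This file makes the threshold a theorem:
* `LawDec.twoBlob_topFlipped_lightHeavy_decAtT_of_sharpFloor`, `LawDec.twoBlob_topFlipped_lightLight_decAtT_of_sharpFloor` (+ `_of_le_`):
  the pieces are DEC at EVERY aspect ratio whenever `1 ≤ x³ + x² + 3x` (⟺ `(1 − x)³ ≤ 4x²` ⟺ `x ≥ x* = 0.2955977…`, the real root of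
  `x³ + x² + 3x = 1`); capacity forms `topFlipped_capacity_LH_sharp` / `_LL_sharp` (the slab `x* ≤ x ≤ 1/3` by the new cells of parts 1–2,
  above `1/3` by g31's floor theorems).
* the companion `…TwoBlobTopFlippedLightSharpFloorWitnesses` has the other direction: for EVERY floor with `x³ + x² + 3x < 1` the
  light–heavy capacity inequality fails (`topFlipped_capacity_LH_fails_below_threshold`), and kernel `¬ DECAtT` witnesses at `x = 1/5`
  (aspect 10 light–heavy; census-2 g59's aspect-7 light ⊗ light raw cell of `LightSliceWide`) — so the `LightSliceWide` residue of (II) is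
  genuinely POOLED below the threshold, while at floors `x ≥ x*` every top-flipped light piece is standalone DEC whatever the spans.
EXACT STRUCTURE (seat folder `work/sharp`): in the single-low capacity inequality the tight set at `x = x*` is the isolated point "short cell
incompatible (raised rate 1), its own rate at the heavy boundary `x`, aspect `x/2`", on whose face the reduced slack is
`x·((1−x)³(s − x/2)² + (x²/4)(x³ + x² + 3x − 1))`; hence the split certificates of part 1.

[this work]; DEC rules ARCH-TREES-G49 §2.2 / DEC-TAMP-G50 §3.1, the single-low criterion `…QuantSingleLowCapacity` (typer g23), the
cell-certificate pipeline FOR-PROVERS-CERT-PIPELINE (typer g23), the (II) piece anatomy FOR-PROVERS-CONV-PIECES (lead g26), the residue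
`LightSliceWide` (census-2 g59) — this lane.  Nothing here is cited as a published result.  The gluing rows served
[cite: KozmaNitzan2024, Conjecture 3 (p. 15)]; product measure [cite: Grimmett1999, §1.3 p. 10].
-/

noncomputable section

namespace Summit.CriticalPhenomena.PercolationContinuityZ3.Theorems

namespace Quant

open Finset

/-- the two-blob law `(1−u)(1−v)δ₀ + u(1−v)δ_a + (1−u)vδ_b + uvδ_{a+b}` evaluated at `h` (as in `…QuantBlobDecTwoLawParts`) -/
local notation3 "LAW2[" a ", " u ", " b ", " v ", " h "]" =>
  (1 - (u : ℝ)) * (1 - (v : ℝ)) * (if (h : ℕ) = 0 then (1 : ℝ) else 0)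
    + (u : ℝ) * (1 - (v : ℝ)) * (if (h : ℕ) = (a : ℕ) then (1 : ℝ) else 0)
    + (1 - (u : ℝ)) * (v : ℝ) * (if (h : ℕ) = (b : ℕ) then (1 : ℝ) else 0)
    + (u : ℝ) * (v : ℝ) * (if (h : ℕ) = (a : ℕ) + (b : ℕ) then (1 : ℝ) else 0)

namespace LawDec

/-! ### The real inequalities on the slab `x* ≤ x ≤ 1/3` -/


/-- CORE (L⊗H), slab `x* ≤ x ≤ 1/3`: capacity inequality of the top-flipped light–heavy piece, every aspect ratio. -/
theorem topFlipped_capacity_LH_slab (x p q P' Q' : ℝ) (hx0 : 0 < x) (hx1 : x < 1) (hp0 : 0 < p) (hpx : p < x)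
    (hxq : x ≤ q) (hq1 : q ≤ 1) (hP : p < P') (hrel : (P' - p) * (Q' - q) = p * q) (hxS : 1 ≤ x ^ 3 + x ^ 2 + 3 * x) (hx3 : x ≤ 1 / 3)
    (hP2 : P' ≤ 2) (hQ2 : Q' ≤ 2) :
    x / (1 - x) * ((1 - (x ^ 2 + (1 - x) * p)) * (1 - q)) ≤
      (if P' < 1 then x / (1 - x) * ((1 - max P' (x ^ 2 + (1 - x) * P')) / max P' (x ^ 2 + (1 - x) * P')) else 0)
          * ((x ^ 2 + (1 - x) * p) * (1 - q))
        + (if Q' < 1 then x / (1 - x) * ((1 - max Q' (x ^ 2 + (1 - x) * Q')) / max Q' (x ^ 2 + (1 - x) * Q')) else 0)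
          * ((1 - (x ^ 2 + (1 - x) * p)) * q)
        + (x ^ 2 + (1 - x) * p) * q := by
  have h1x : 0 < 1 - x := by linarith
  have hPp : 0 < P' - p := by linarith
  have hq0 : 0 < q := by linarith
  have hQ' : Q' = q * P' / (P' - p) := by
    rw [eq_div_iff hPp.ne']; linear_combination hrel
  have hQd : Q' - q = p * q / (P' - p) := by
    rw [eq_div_iff hPp.ne']; linear_combination hrel
  have hQq : q < Q' := by
    have : 0 < p * q / (P' - p) := div_pos (mul_pos hp0 hq0) hPp
    linarith
  have hxQ : x ≤ Q' := by linarith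
  have hmaxQ : max Q' (x ^ 2 + (1 - x) * Q') = Q' := max_eq_left (by nlinarith)
  rw [hmaxQ]
  by_cases hP1 : P' < 1
  · rw [if_pos hP1]
    by_cases hQ1 : Q' < 1
    · rw [if_pos hQ1]
      have hQ1' : q * P' < P' - p := by rw [hQ', div_lt_one hPp] at hQ1; exact hQ1
      have hQ2' : q * P' ≤ 2 * (P' - p) := by rw [hQ', div_le_iff₀ hPp] at hQ2; linarith
      rcases le_or_gt P' x with hPx | hxP
      · rw [max_eq_right (by nlinarith : P' ≤ x ^ 2 + (1 - x) * P'), hQ']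
        exact tfpCellS_LH_LH x p q P' hx0 hx1 hp0 hpx hxq hq1 hP hxS hx3 hPx hQ1' hP2 hQ2'
      · rw [max_eq_left (by nlinarith : x ^ 2 + (1 - x) * P' ≤ P'), hQ']
        exact tfpCellS_LH_HH x p q P' hx0 hx1 hp0 hpx hxq hq1 hP hxS hx3 hxP.le hP1 hQ1' hP2 hQ2'
    · rw [if_neg hQ1]
      have h1Q' : P' - p ≤ q * P' := by
        push Not at hQ1; rw [hQ', le_div_iff₀ hPp] at hQ1; linarith
      have hQ2' : q * P' ≤ 2 * (P' - p) := by rw [hQ', div_le_iff₀ hPp] at hQ2; linarith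
      rcases le_or_gt P' x with hPx | hxP
      · rw [max_eq_right (by nlinarith : P' ≤ x ^ 2 + (1 - x) * P')]
        exact tfpCellS_LH_L1 x p q P' hx0 hx1 hp0 hpx hxq hq1 hP hxS hx3 hPx h1Q' hP2 hQ2'
      · rw [max_eq_left (by nlinarith : x ^ 2 + (1 - x) * P' ≤ P')]
        exact tfpCellS_LH_H1 x p q P' hx0 hx1 hp0 hpx hxq hq1 hP hxS hx3 hxP.le hP1 h1Q' hP2 hQ2'
  · rw [if_neg hP1]
    push Not at hP1
    have hPp1 : 1 - p ≤ P' - p := by linarith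
    have h1p : 0 < 1 - p := by linarith
    have hPge1 : Q' * (1 - p) ≤ q := by
      have h1 : p * q / (P' - p) ≤ p * q / (1 - p) :=
        div_le_div_of_nonneg_left (mul_pos hp0 hq0).le h1p hPp1
      have h2 : Q' - q ≤ p * q / (1 - p) := by rw [hQd]; exact h1
      have h3 : (Q' - q) * (1 - p) ≤ p * q := by rw [le_div_iff₀ h1p] at h2; exact h2
      linarith
    by_cases hQ1 : Q' < 1
    · rw [if_pos hQ1]
      exact tfpCellS_LH_1H x p q Q' hx0 hx1 hp0 hpx hxq hq1 hQq hPge1 hxS hx3 hxQ hQ1 hQ2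
    · rw [if_neg hQ1]
      push Not at hQ1
      exact tfpCellS_LH_11 x p q Q' hx0 hx1 hp0 hpx hxq hq1 hQq hPge1 hxS hx3 hQ1 hQ2


/-- CORE (L⊗L), slab `x* ≤ x ≤ 1/3`: capacity inequality of the top-flipped light–light piece, longer blob second (`q ≤ P′ − p`), every aspect ratio. -/
theorem topFlipped_capacity_LL_slab (x p q P' Q' : ℝ) (hx0 : 0 < x) (hx1 : x < 1) (hp0 : 0 < p) (hpx : p < x)
    (hq0 : 0 < q) (hqx : q < x) (hP : p < P') (hrel : (P' - p) * (Q' - q) = p * q) (hr1 : q ≤ P' - p)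
    (hxS : 1 ≤ x ^ 3 + x ^ 2 + 3 * x) (hx3 : x ≤ 1 / 3) (hP2 : P' ≤ 2) (hQ2 : Q' ≤ 2) :
    x / (1 - x) * ((1 - (x ^ 2 + (1 - x) * p)) * (1 - (x ^ 2 + (1 - x) * q))) ≤
      (if P' < 1 then x / (1 - x) * ((1 - max P' (x ^ 2 + (1 - x) * P')) / max P' (x ^ 2 + (1 - x) * P')) else 0)
          * ((x ^ 2 + (1 - x) * p) * (1 - (x ^ 2 + (1 - x) * q)))
        + (if Q' < 1 then x / (1 - x) * ((1 - max Q' (x ^ 2 + (1 - x) * Q')) / max Q' (x ^ 2 + (1 - x) * Q')) else 0)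
          * ((1 - (x ^ 2 + (1 - x) * p)) * (x ^ 2 + (1 - x) * q))
        + (x ^ 2 + (1 - x) * p) * (x ^ 2 + (1 - x) * q) := by
  have h1x : 0 < 1 - x := by linarith
  have hPp : 0 < P' - p := by linarith
  have hQ' : Q' = q * P' / (P' - p) := by
    rw [eq_div_iff hPp.ne']; linear_combination hrel
  have hQd : Q' - q = p * q / (P' - p) := by
    rw [eq_div_iff hPp.ne']; linear_combination hrel
  have hQq : q < Q' := by
    have : 0 < p * q / (P' - p) := div_pos (mul_pos hp0 hq0) hPp
    linarith
  have hQP : Q' ≤ P' := by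
    rw [hQ', div_le_iff₀ hPp]; nlinarith
  by_cases hP1 : P' < 1
  · rw [if_pos hP1]
    have hQ1 : Q' < 1 := lt_of_le_of_lt hQP hP1
    rw [if_pos hQ1]
    have hQ2' : q * P' ≤ 2 * (P' - p) := by rw [hQ', div_le_iff₀ hPp] at hQ2; linarith
    rcases le_or_gt P' x with hPx | hxP
    · -- P light, hence Q light
      have hQx : Q' ≤ x := hQP.trans hPx
      have hQx' : q * P' ≤ x * (P' - p) := by rw [hQ', div_le_iff₀ hPp] at hQx; linarith
      rw [max_eq_right (by nlinarith : P' ≤ x ^ 2 + (1 - x) * P'),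
        max_eq_right (by nlinarith : Q' ≤ x ^ 2 + (1 - x) * Q'), hQ']
      exact tfpCellS_LL_LL x p q P' hx0 hx1 hp0 hpx hq0 hqx hP hr1 hxS hx3 hPx hQx' hP2 hQ2'
    · rw [max_eq_left (by nlinarith : x ^ 2 + (1 - x) * P' ≤ P')]
      rcases le_or_gt Q' x with hQx | hxQ
      · have hQx' : q * P' ≤ x * (P' - p) := by rw [hQ', div_le_iff₀ hPp] at hQx; linarith
        rw [max_eq_right (by nlinarith : Q' ≤ x ^ 2 + (1 - x) * Q'), hQ']
        exact tfpCellS_LL_HL x p q P' hx0 hx1 hp0 hpx hq0 hqx hP hr1 hxS hx3 hxP.le hP1 hQx' hP2 hQ2'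
      · have hxQ' : x * (P' - p) ≤ q * P' := by
          have := hxQ.le; rw [hQ', le_div_iff₀ hPp] at this; linarith
        have hQ1' : q * P' < P' - p := by rw [hQ', div_lt_one hPp] at hQ1; exact hQ1
        rw [max_eq_left (by nlinarith : x ^ 2 + (1 - x) * Q' ≤ Q'), hQ']
        exact tfpCellS_LL_HH x p q P' hx0 hx1 hp0 hpx hq0 hqx hP hr1 hxS hx3 hxP.le hP1 hxQ' hQ1' hP2 hQ2'
  · rw [if_neg hP1]
    push Not at hP1
    have hPp1 : 1 - p ≤ P' - p := by linarith
    have h1p : 0 < 1 - p := by linarith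
    have hPge1 : Q' * (1 - p) ≤ q := by
      have h1 : p * q / (P' - p) ≤ p * q / (1 - p) :=
        div_le_div_of_nonneg_left (mul_pos hp0 hq0).le h1p hPp1
      have h2 : Q' - q ≤ p * q / (1 - p) := by rw [hQd]; exact h1
      have h3 : (Q' - q) * (1 - p) ≤ p * q := by rw [le_div_iff₀ h1p] at h2; exact h2
      linarith
    have hr1' : Q' - q ≤ p := by
      have h1 : p * q / (P' - p) ≤ p * q / q :=
        div_le_div_of_nonneg_left (mul_pos hp0 hq0).le hq0 hr1
      rw [hQd]
      calc p * q / (P' - p) ≤ p * q / q := h1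
        _ = p := by field_simp
    by_cases hQ1 : Q' < 1
    · rw [if_pos hQ1]
      rcases le_or_gt Q' x with hQx | hxQ
      · rw [max_eq_right (by nlinarith : Q' ≤ x ^ 2 + (1 - x) * Q')]
        exact tfpCellS_LL_1L x p q Q' hx0 hx1 hp0 hpx hq0 hqx hQq hPge1 hr1' hxS hx3 hQx hQ2
      · rw [max_eq_left (by nlinarith : x ^ 2 + (1 - x) * Q' ≤ Q')]
        exact tfpCellS_LL_1H x p q Q' hx0 hx1 hp0 hpx hq0 hqx hQq hPge1 hr1' hxS hx3 hxQ.le hQ1 hQ2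
    · rw [if_neg hQ1]
      push Not at hQ1
      exact tfpCellS_LL_11 x p q Q' hx0 hx1 hp0 hpx hq0 hqx hQq hPge1 hr1' hxS hx3 hQ1 hQ2


/-! ### The real inequalities at the sharp floor `x³ + x² + 3x ≥ 1` -/

/-- **CORE (L⊗H), SHARP FLOOR**: the capacity inequality of the top-flipped light–heavy piece at every aspect ratio, for every floor with
`1 ≤ x³ + x² + 3x` (the slab by the new cells, `x ≥ 1/3` by arm-2 g31's `topFlipped_capacity_LH_floor`). [this work] -/
theorem topFlipped_capacity_LH_sharp (x p q P' Q' : ℝ) (hx0 : 0 < x) (hx1 : x < 1) (hp0 : 0 < p) (hpx : p < x)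
    (hxq : x ≤ q) (hq1 : q ≤ 1) (hP : p < P') (hrel : (P' - p) * (Q' - q) = p * q) (hxS : 1 ≤ x ^ 3 + x ^ 2 + 3 * x)
    (hP2 : P' ≤ 2) (hQ2 : Q' ≤ 2) :
    x / (1 - x) * ((1 - (x ^ 2 + (1 - x) * p)) * (1 - q)) ≤
      (if P' < 1 then x / (1 - x) * ((1 - max P' (x ^ 2 + (1 - x) * P')) / max P' (x ^ 2 + (1 - x) * P')) else 0)
          * ((x ^ 2 + (1 - x) * p) * (1 - q))
        + (if Q' < 1 then x / (1 - x) * ((1 - max Q' (x ^ 2 + (1 - x) * Q')) / max Q' (x ^ 2 + (1 - x) * Q')) else 0)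
          * ((1 - (x ^ 2 + (1 - x) * p)) * q)
        + (x ^ 2 + (1 - x) * p) * q := by
  rcases le_total ((1:ℝ) / 3) x with h3 | h3
  · exact topFlipped_capacity_LH_floor x p q P' Q' hx0 hx1 hp0 hpx hxq hq1 hP hrel h3 hP2 hQ2
  · exact topFlipped_capacity_LH_slab x p q P' Q' hx0 hx1 hp0 hpx hxq hq1 hP hrel hxS (by linarith) hP2 hQ2

/-- **CORE (L⊗L), SHARP FLOOR**: the capacity inequality of the top-flipped light–light piece, longer blob second, at every aspect ratio,
for every floor with `1 ≤ x³ + x² + 3x`. [this work] -/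
theorem topFlipped_capacity_LL_sharp (x p q P' Q' : ℝ) (hx0 : 0 < x) (hx1 : x < 1) (hp0 : 0 < p) (hpx : p < x)
    (hq0 : 0 < q) (hqx : q < x) (hP : p < P') (hrel : (P' - p) * (Q' - q) = p * q) (hr1 : q ≤ P' - p)
    (hxS : 1 ≤ x ^ 3 + x ^ 2 + 3 * x) (hP2 : P' ≤ 2) (hQ2 : Q' ≤ 2) :
    x / (1 - x) * ((1 - (x ^ 2 + (1 - x) * p)) * (1 - (x ^ 2 + (1 - x) * q))) ≤
      (if P' < 1 then x / (1 - x) * ((1 - max P' (x ^ 2 + (1 - x) * P')) / max P' (x ^ 2 + (1 - x) * P')) else 0)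
          * ((x ^ 2 + (1 - x) * p) * (1 - (x ^ 2 + (1 - x) * q)))
        + (if Q' < 1 then x / (1 - x) * ((1 - max Q' (x ^ 2 + (1 - x) * Q')) / max Q' (x ^ 2 + (1 - x) * Q')) else 0)
          * ((1 - (x ^ 2 + (1 - x) * p)) * (x ^ 2 + (1 - x) * q))
        + (x ^ 2 + (1 - x) * p) * (x ^ 2 + (1 - x) * q) := by
  rcases le_total ((1:ℝ) / 3) x with h3 | h3
  · exact topFlipped_capacity_LL_floor x p q P' Q' hx0 hx1 hp0 hpx hq0 hqx hP hrel hr1 h3 hP2 hQ2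
  · exact topFlipped_capacity_LL_slab x p q P' Q' hx0 hx1 hp0 hpx hq0 hqx hP hrel hr1 hxS (by linarith) hP2 hQ2

/-! ### Assembly: the `DECAtT` statements at the sharp floor -/


/-- **THE TOP-FLIPPED LIGHT–HEAVY PIECE AT THE SHARP FLOOR** `1 ≤ x³ + x² + 3x`: DEC at every aspect ratio. [this work] -/
theorem twoBlob_topFlipped_lightHeavy_decAtT_of_sharpFloor (x γ g : ℝ) (A B j : ℕ) (hx0 : 0 < x) (hx1 : x < 1)
    (hγ0 : x ^ 2 < γ) (hγx : γ < x) (hxg : x ≤ g) (hg1 : g ≤ 1) (hA : 1 ≤ A) (hB : 1 ≤ B) (hxS : 1 ≤ x ^ 3 + x ^ 2 + 3 * x)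
    (hAj : A ≤ j) (hBj : B ≤ j) (hj : j + 1 ≤ A + B)
    (hcA : (A : ℝ) * ((γ - x ^ 2) / (1 - x)) + (B : ℝ) * g ≤ 2 * (A : ℝ))
    (hcB : (A : ℝ) * ((γ - x ^ 2) / (1 - x)) + (B : ℝ) * g ≤ 2 * (B : ℝ)) :
    DECAtT x ((A : ℝ) * ((γ - x ^ 2) / (1 - x)) + (B : ℝ) * g) j (A + B) (fun h => LAW2[A, γ, B, g, h]) := by
  classical
  have h1x : 0 < 1 - x := by linarith
  set p : ℝ := (γ - x ^ 2) / (1 - x) with hp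
  have hp0 : 0 < p := div_pos (by linarith) h1x
  have hpx : p < x := by rw [hp, div_lt_iff₀ h1x]; nlinarith
  have hγp : γ = x ^ 2 + (1 - x) * p := by rw [hp]; field_simp; ring
  set c : ℝ := (A : ℝ) * p + (B : ℝ) * g with hc
  have hA0 : (0 : ℝ) < A := by exact_mod_cast hA
  have hB0 : (0 : ℝ) < B := by exact_mod_cast hB
  have hg0 : 0 < g := lt_of_lt_of_le hx0 hxg
  have hc0 : 0 < c := by rw [hc]; positivity
  have hγ0' : 0 ≤ γ := by nlinarith
  have hγ1 : γ ≤ 1 := by linarith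
  -- the single-low criterion
  have hν0 : ∀ k, 0 ≤ LAW2[A, γ, B, g, k] := fun k => BlobDec2.law_nonneg A B γ g hγ0' hγ1 hg0.le hg1 k
  have hνM : ∀ k, A + B < k → LAW2[A, γ, B, g, k] = 0 := fun k hk => BlobDec2.law_eq_zero_of_lt A B γ g k hk
  have hν1 : ∑ h ∈ Finset.range (A + B + 1), LAW2[A, γ, B, g, h] = 1 := BlobDec2.law_mass A B γ g
  have hsingle : ∀ k, k ≤ j → 2 * (k : ℝ) < c → k ≠ 0 → LAW2[A, γ, B, g, k] = 0 := by
    intro k hkj hk hk0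
    have hkA : k ≠ A := by rintro rfl; linarith
    have hkB : k ≠ B := by rintro rfl; linarith
    have hkAB : k ≠ A + B := by omega
    simp [hk0, hkA, hkB, hkAB]
  rw [(decAtT_singleLow_iff x c j (A + B) 0 _ hx0 hx1 hν0 hνM hν1 (Nat.zero_le _) (by simpa using hc0) hsingle)]
  -- evaluate both sides
  have hA0n : A ≠ 0 := by omega
  have hB0n : B ≠ 0 := by omega
  have hAB0 : A + B ≠ 0 := by omega
  have lhs : LAW2[A, γ, B, g, 0] = (1 - γ) * (1 - g) := by
    simp [hA0n.symm, hB0n.symm, hAB0.symm]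
  rw [lhs]
  have rhs : ∑ h ∈ Finset.range (A + B + 1), capCoef x c j 0 h * LAW2[A, γ, B, g, h]
      = capCoef x c j 0 A * (γ * (1 - g)) + capCoef x c j 0 B * ((1 - γ) * g) + γ * g := by
    simp_rw [mul_add, Finset.sum_add_distrib]
    rw [sum_range_mul_const_indicator _ 0 (Nat.zero_le _), sum_range_mul_const_indicator _ A (by omega),
      sum_range_mul_const_indicator _ B (by omega), sum_range_mul_const_indicator _ (A + B) le_rfl,
      capCoef_zero_self x c j hc0, capCoef_giant x c j 0 (A + B) hj]
    ring
  rw [rhs]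
  -- the two mid coefficients in closed form
  have hPrel : (c / A - p) * (c / B - g) = p * g := by
    rw [hc]; field_simp; ring
  have key := topFlipped_capacity_LH_sharp x p g (c / A) (c / B) hx0 hx1 hp0 hpx hxg hg1
    (by rw [hc, lt_div_iff₀ hA0]; nlinarith) hPrel
    hxS
    (by rw [div_le_iff₀ hA0]; linarith) (by rw [div_le_iff₀ hB0]; linarith)
  have eA : capCoef x c j 0 A = (if c / A < 1 then x / (1 - x) * ((1 - max (c / A) (x ^ 2 + (1 - x) * (c / A))) / max (c / A) (x ^ 2 + (1 - x) * (c / A))) else 0) := by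
    split_ifs with hlt
    · exact capCoef_zero_mid x c j A hx0 hx1 hAj hc0 (by linarith) (by rwa [div_lt_one hA0] at hlt)
    · exact capCoef_zero_mid_incompat x c j A hAj (by push Not at hlt; rwa [one_le_div hA0] at hlt)
  have eB : capCoef x c j 0 B = (if c / B < 1 then x / (1 - x) * ((1 - max (c / B) (x ^ 2 + (1 - x) * (c / B))) / max (c / B) (x ^ 2 + (1 - x) * (c / B))) else 0) := by
    split_ifs with hlt
    · exact capCoef_zero_mid x c j B hx0 hx1 hBj hc0 (by linarith) (by rwa [div_lt_one hB0] at hlt)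
    · exact capCoef_zero_mid_incompat x c j B hBj (by push Not at hlt; rwa [one_le_div hB0] at hlt)
  rw [eA, eB, hγp]
  exact key

set_option maxHeartbeats 1600000 in
/-- **THE TOP-FLIPPED LIGHT–LIGHT PIECE AT THE SHARP FLOOR, longer blob second** (`A ≤ B`, `1 ≤ x³ + x² + 3x`): DEC at every aspect ratio. [this work] -/
theorem twoBlob_topFlipped_lightLight_decAtT_of_le_of_sharpFloor (x γ₁ γ₂ : ℝ) (A B j : ℕ) (hx0 : 0 < x) (hx1 : x < 1)
    (h1 : x ^ 2 < γ₁) (h1x' : γ₁ < x) (h2 : x ^ 2 < γ₂) (h2x : γ₂ < x) (hA : 1 ≤ A) (hAB : A ≤ B) (hxS : 1 ≤ x ^ 3 + x ^ 2 + 3 * x)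
    (hAj : A ≤ j) (hBj : B ≤ j) (hj : j + 1 ≤ A + B)
    (hcA : (A : ℝ) * ((γ₁ - x ^ 2) / (1 - x)) + (B : ℝ) * ((γ₂ - x ^ 2) / (1 - x)) ≤ 2 * (A : ℝ))
    (hcB : (A : ℝ) * ((γ₁ - x ^ 2) / (1 - x)) + (B : ℝ) * ((γ₂ - x ^ 2) / (1 - x)) ≤ 2 * (B : ℝ)) :
    DECAtT x ((A : ℝ) * ((γ₁ - x ^ 2) / (1 - x)) + (B : ℝ) * ((γ₂ - x ^ 2) / (1 - x))) j (A + B)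
      (fun h => LAW2[A, γ₁, B, γ₂, h]) := by
  classical
  have h1x : 0 < 1 - x := by linarith
  set p : ℝ := (γ₁ - x ^ 2) / (1 - x) with hp
  set q : ℝ := (γ₂ - x ^ 2) / (1 - x) with hq
  have hp0 : 0 < p := div_pos (by linarith) h1x
  have hpx : p < x := by rw [hp, div_lt_iff₀ h1x]; nlinarith
  have hq0 : 0 < q := div_pos (by linarith) h1x
  have hqx : q < x := by rw [hq, div_lt_iff₀ h1x]; nlinarith
  have hγp : γ₁ = x ^ 2 + (1 - x) * p := by rw [hp]; field_simp; ring
  have hγq : γ₂ = x ^ 2 + (1 - x) * q := by rw [hq]; field_simp; ring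
  set c : ℝ := (A : ℝ) * p + (B : ℝ) * q with hc
  have hA0 : (0 : ℝ) < A := by exact_mod_cast hA
  have hB0 : (0 : ℝ) < B := by exact_mod_cast (le_trans hA hAB)
  have hc0 : 0 < c := by rw [hc]; positivity
  have hγ10 : 0 ≤ γ₁ := by nlinarith
  have hγ11 : γ₁ ≤ 1 := by linarith
  have hγ20 : 0 ≤ γ₂ := by nlinarith
  have hγ21 : γ₂ ≤ 1 := by linarith
  have hν0 : ∀ k, 0 ≤ LAW2[A, γ₁, B, γ₂, k] := fun k => BlobDec2.law_nonneg A B γ₁ γ₂ hγ10 hγ11 hγ20 hγ21 k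
  have hνM : ∀ k, A + B < k → LAW2[A, γ₁, B, γ₂, k] = 0 := fun k hk => BlobDec2.law_eq_zero_of_lt A B γ₁ γ₂ k hk
  have hν1 : ∑ h ∈ Finset.range (A + B + 1), LAW2[A, γ₁, B, γ₂, h] = 1 := BlobDec2.law_mass A B γ₁ γ₂
  have hsingle : ∀ k, k ≤ j → 2 * (k : ℝ) < c → k ≠ 0 → LAW2[A, γ₁, B, γ₂, k] = 0 := by
    intro k hkj hk hk0
    have hkA : k ≠ A := by rintro rfl; linarith
    have hkB : k ≠ B := by rintro rfl; linarith
    have hkAB : k ≠ A + B := by omega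
    simp [hk0, hkA, hkB, hkAB]
  rw [(decAtT_singleLow_iff x c j (A + B) 0 _ hx0 hx1 hν0 hνM hν1 (Nat.zero_le _) (by simpa using hc0) hsingle)]
  have hA0n : A ≠ 0 := by omega
  have hB0n : B ≠ 0 := by omega
  have hAB0 : A + B ≠ 0 := by omega
  have lhs : LAW2[A, γ₁, B, γ₂, 0] = (1 - γ₁) * (1 - γ₂) := by
    simp [hA0n.symm, hB0n.symm, hAB0.symm]
  rw [lhs]
  have rhs : ∑ h ∈ Finset.range (A + B + 1), capCoef x c j 0 h * LAW2[A, γ₁, B, γ₂, h]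
      = capCoef x c j 0 A * (γ₁ * (1 - γ₂)) + capCoef x c j 0 B * ((1 - γ₁) * γ₂) + γ₁ * γ₂ := by
    simp_rw [mul_add, Finset.sum_add_distrib]
    rw [sum_range_mul_const_indicator _ 0 (Nat.zero_le _), sum_range_mul_const_indicator _ A (by omega),
      sum_range_mul_const_indicator _ B (by omega), sum_range_mul_const_indicator _ (A + B) le_rfl,
      capCoef_zero_self x c j hc0, capCoef_giant x c j 0 (A + B) hj]
    ring
  rw [rhs]
  have hPrel : (c / A - p) * (c / B - q) = p * q := by
    rw [hc]; field_simp; ring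
  have hAB' : (A : ℝ) ≤ B := by exact_mod_cast hAB
  have e1 : c / A - p = B * q / A := by rw [hc]; field_simp; ring
  have key := topFlipped_capacity_LL_sharp x p q (c / A) (c / B) hx0 hx1 hp0 hpx hq0 hqx
    (by rw [hc, lt_div_iff₀ hA0]; nlinarith) hPrel
    (by rw [e1, le_div_iff₀ hA0]; nlinarith [mul_le_mul_of_nonneg_right hAB' hq0.le])
    hxS
    (by rw [div_le_iff₀ hA0]; linarith) (by rw [div_le_iff₀ hB0]; linarith)
  have eA : capCoef x c j 0 A = (if c / A < 1 then x / (1 - x) * ((1 - max (c / A) (x ^ 2 + (1 - x) * (c / A))) / max (c / A) (x ^ 2 + (1 - x) * (c / A))) else 0) := by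
    split_ifs with hlt
    · exact capCoef_zero_mid x c j A hx0 hx1 hAj hc0 (by linarith) (by rwa [div_lt_one hA0] at hlt)
    · exact capCoef_zero_mid_incompat x c j A hAj (by push Not at hlt; rwa [one_le_div hA0] at hlt)
  have eB : capCoef x c j 0 B = (if c / B < 1 then x / (1 - x) * ((1 - max (c / B) (x ^ 2 + (1 - x) * (c / B))) / max (c / B) (x ^ 2 + (1 - x) * (c / B))) else 0) := by
    split_ifs with hlt
    · exact capCoef_zero_mid x c j B hx0 hx1 hBj hc0 (by linarith) (by rwa [div_lt_one hB0] at hlt)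
    · exact capCoef_zero_mid_incompat x c j B hBj (by push Not at hlt; rwa [one_le_div hB0] at hlt)
  rw [eA, eB, hγp, hγq]
  exact key

/-- **THE TOP-FLIPPED LIGHT–LIGHT PIECE AT THE SHARP FLOOR** `1 ≤ x³ + x² + 3x`: DEC at every aspect ratio. [this work] -/
theorem twoBlob_topFlipped_lightLight_decAtT_of_sharpFloor (x γ₁ γ₂ : ℝ) (A B j : ℕ) (hx0 : 0 < x) (hx1 : x < 1)
    (h1 : x ^ 2 < γ₁) (h1x' : γ₁ < x) (h2 : x ^ 2 < γ₂) (h2x : γ₂ < x) (hA : 1 ≤ A) (hB : 1 ≤ B)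
    (hxS : 1 ≤ x ^ 3 + x ^ 2 + 3 * x) (hAj : A ≤ j) (hBj : B ≤ j) (hj : j + 1 ≤ A + B)
    (hcA : (A : ℝ) * ((γ₁ - x ^ 2) / (1 - x)) + (B : ℝ) * ((γ₂ - x ^ 2) / (1 - x)) ≤ 2 * (A : ℝ))
    (hcB : (A : ℝ) * ((γ₁ - x ^ 2) / (1 - x)) + (B : ℝ) * ((γ₂ - x ^ 2) / (1 - x)) ≤ 2 * (B : ℝ)) :
    DECAtT x ((A : ℝ) * ((γ₁ - x ^ 2) / (1 - x)) + (B : ℝ) * ((γ₂ - x ^ 2) / (1 - x))) j (A + B)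
      (fun h => LAW2[A, γ₁, B, γ₂, h]) := by
  rcases le_total A B with hle | hle
  · exact twoBlob_topFlipped_lightLight_decAtT_of_le_of_sharpFloor x γ₁ γ₂ A B j hx0 hx1 h1 h1x' h2 h2x hA hle hxS hAj hBj hj hcA hcB
  · have hsw := twoBlob_topFlipped_lightLight_decAtT_of_le_of_sharpFloor x γ₂ γ₁ B A j hx0 hx1 h2 h2x h1 h1x' hB hle hxS hBj hAj
      (by omega) (by linarith) (by linarith)
    rw [law2_swap A B γ₂ γ₁] at hsw
    have ec : (B : ℝ) * ((γ₂ - x ^ 2) / (1 - x)) + (A : ℝ) * ((γ₁ - x ^ 2) / (1 - x))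
        = (A : ℝ) * ((γ₁ - x ^ 2) / (1 - x)) + (B : ℝ) * ((γ₂ - x ^ 2) / (1 - x)) := by ring
    rw [ec, Nat.add_comm B A] at hsw
    exact hsw

end LawDec

end Quant

end Summit.CriticalPhenomena.PercolationContinuityZ3.Theorems
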